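import Literature.MathematicalPhysics.QuantumFieldTheory.Balaban1983to89.T4FlagMemory
import Literature.MathematicalPhysics.QuantumFieldTheory.Balaban1983to89.T4TwoRunMatching

/-!
# `Balaban1983to89.T4FlagMemoryTwoRun` — NE4 (node U2): the JOIN of the two prover typings — the four one-step inputs of
the growing-flag scheme (`T4FlagMemory`, technique P1) DELIVER the two located estimates of the two-trajectory system
(`T4TwoRunMatching.TwoRunRenewal` / `TwoRunReadOut`, technique P2), so ONE hypothesis set feeds BOTH closures of node U2.
Kernel bookkeeping (prefix locality of the flag, one triangle inequality); nothing about Bałaban's objects is asserted.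

HONEST FRAMING (cell `pub-balaban`, T4-DAG PAGE 1).  The cell's T4 target is rung (B)+1 — existence AND uniqueness of
the ε → 0 limit of Bałaban's unit-scale averaged expectations on a FIXED finite torus; NOT infinite volume, NOT a mass
gap, NOT the Clay problem.  This module belongs to spine estimate NE4 (η-rate of the full β_k, node U2), which the cell's
T⁴ fan-out typed twice: (P1) `T4FlagMemory` — a β-family READ OFF the entries generated by a family of one-step maps
`Φ j : ℝ → (ℕ → X) → X` with the four hypothesis shapes `StepDirect` (direct modulus ℓ′ in the own coupling),
`StepMemory` + `T4CouplingMatching.FadingMemory C′ ω M′` (functional memory of the older entries, fading with the age),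
`StepShift` (one-step source of the scale shift, `src k ≤ aρ^k`), `ReadLipschitz` (read-out constant cr), concluding node
U2's BOX-UNIFORM inputs `ScaleShiftRate` / `HistLipschitz` / `FadingMemory` and, through
`T4CouplingMatching.injectedRate_of_runs_eventual`, the spine's `T4CauchySum.InjectedRate`; (P2) `T4TwoRunMatching` — the
two located estimates ALONG TWO RUNS, `TwoRunRenewal a ℓ′ ρ M` (discrepancy majorant of the matched pairs of brackets:
source + birth term + memory) and `TwoRunReadOut S r` (β¹-mismatch ≤ r × majorant), closed by ONE weighted-maximum fixed
point (`disc_le_of_twoRun`, `injectedRate_of_twoRun_runs`).  THIS MODULE proves that (P1)'s four one-step inputs IMPLY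
(P2)'s two located estimates for every pair of runs in the box (§2), with the majorant DEFINED from the scheme
(`pairDist`: the distance between run B's entry born at j + 1 and run A's entry born at j along the clamped coupling
sequences), and composes with (P2)'s closure BY NAME (§3).  Consequence for the cell's booking of NE4 (companion record
`t4/T4-EST-NE4-P1.md` v1.2 §7–§8): the SAME located inputs — (M) = `StepMemory`/`FadingMemory` (NOT PRINTED; split in
`T4FlagMemory` §6 into the printed-structure activity insertion and the kernel activity-to-value modulus), (S) =
`StepShift` (cell NE2/NE3/NE5), (D) = `StepDirect` (printed type, [Balaban1987RG1] p. 264; k-uniformity unprinted),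
(R) = `ReadLipschitz` — feed two closures whose REMAINING CONDITIONALS differ and are now comparable declaration by
declaration:
* box-uniform (`T4FlagMemory.injectedRate_of_scheme`, here in split form `injectedRate_of_split_scheme_eventual`): the
  printed recursion (0.20) for the runs, the box ]0,γ], the infrared pin, (AF-0r) `|β⁰_{k+1} − β∞| ≤ c₀ρ^k`, an EVENTUAL
  LOWER BOUND `EventualLowerH b γ k₀ β` on the β-functions (β sub-cell, `LimitForm.tail_lower` shape) and the window
  `cr·ℓ′·((k₀+1)γ³ + 2γ/b) ≤ (1 − ρ)/2`;
* two-run (`injectedRate_of_scheme_twoRun`): the same runs / box / pin / (AF-0r), NO lower bound on β at all, and the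
  window `cr·ℓ′γ³·(ρ − ω)(ρ − (1 + C′)ω)⁻¹ ≤ (1 − ρ)/2`;
both under the memory gap `(1 + C′)ω < ρ < 1`, both with the SAME output constant `2(2c₀ + cr·a·(ρ−ω)(ρ−(1+C′)ω)⁻¹)(1−ρ)⁻¹`
(`rate_constants_agree`).  Where asymptotic freedom enters either closure: only through the EXISTENCE of the pinned runs
inside the box (node U1/H3 — binders `hrun`/`hbox`/`hpin` here, never constructed) and, in the box-uniform closure,
through `EventualLowerH`.  CONDITIONALS BY NAME, never hidden: (AF-0r) is the binder `hconv` (member of the β sub-cell's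
hypothesis package BetaPertH, NOT discharged for Bałaban's β); (B)/(B^μ) enter only the existence of the runs (binders).
VALUE = kernel consolidation of the fan-out's two NE4 typings into one input list with two certified closures; NOT an
estimate on Bałaban's (2.13), NOT summit progress.

WHAT PRINT SAYS (read by THIS seat as images on the ×2 journal-page renders
`b2b-balaban-ref1/pages/1987-cmp109-rg-I-small-field/…-p008-x2.png` (p. 256) and `…-p020-x2.png` (p. 268); the
manuscripts are UNDER ADJUDICATION and are quoted for what they STATE, never as establishing a disputed step):
* [Balaban1987RG1] p. 256: (0.20) *"1/g_k² = 1/g²_{k+1} + β_{k+1}(g_k)"*; *"Let us denote the corresponding index by K,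
  hence ε = L^{−K}, and the sequence of actions and coupling constants is defined for k = 0, 1, …, K."*; *"The function
  E_k depends also on the effective coupling constants g₀, …, g_{k−1}. It is a sum of contributions coming from the k
  successive integrations in the k renormalization transformations. … In the second step a new expression of this type is
  created, in the old only a background field is changed. Thus we obtain after k steps
  E_k(U_k) = Σ_{j=1}^{k} [−β_j(g_{j−1})A^η(U_k) + E^{(j)}(U_k)]. (0.23)"* — the growing flag (one new entry per step,
  old entries never rewritten), whence PREFIX LOCALITY: the entry born at step j is a function of g₀, …, g_j only
  (§1, a theorem of the recursion `T4FlagMemory.flag`, not an assumption).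
* [Balaban1987RG1] p. 268: (2.12) (the expression under the exponential depends on the coupling g_k and, by the
  remark after (2.13), vanishes at g_k = 0; its last term is the curly bracket
  *"{E_k(U_k(exp i[g_kCB − hD̃(g_kCB)]V^{(k)})) − E_k(U_k(V^{(k)}))}"*), *"The integral in (2.12) defines the new term
  E^{(k+1)} in the inductive definition of the action A_{k+1} by the formula
  E^{(k+1)}(g_k, U_{k+1}) = log ∫ dμ_{C^{(k)}}(B)χ_k exp[P^{(k)}(g_k, U_{k+1}, B) + {…}]. (2.13)"*, *"Let us remark that
  the expression under the exponential above vanishes at g_k = 0"*, and (2.15) *"with the β-function defined by the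
  formulas (1.20), (1.22) for j = k"* — the one-step map (coupling g_k; previous flag E_k) ↦ new entry, and the fixed
  read-out of β from the new entry (structural reading, as in `T4FlagMemory` / `T4TwoRunMatching`).
NOT PRINTED anywhere in [I]–[III] (cell cross-reads `t4/T4-XREAD-U2.md` §3, `t4/T4-XREAD-U2R2.md` N1/N2; GAPS G-t4-U2-1,
G-t4-U2-2, G-b12g6-1, G-b12g8-1): any of the four one-step shapes as a quantitative statement, and any comparison of
objects at two lattice spacings; they are hypotheses of every theorem below, none is asserted.

## What is typed and proved

(§1) PREFIX LOCALITY [folklore].  `flag_congr` / `entry_congr`: if two coupling sequences agree on `m < j` (resp.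
`m ≤ j`) their flags before step j (resp. entries born at j) coincide; `extd_prefixOf`: the clamped extension
`extd (prefixOf g N)` of a run's prefix agrees with the run on `m ≤ N`; `entry_extd_prefixOf`: the entry born at `j ≤ N`
is the same along `extd (prefixOf g j)` and `extd (prefixOf g N)` — so `Represents Φ r γ β` reads `β j (prefixOf g j)`
off ONE sequence per run.

(§2) THE JOIN.  `seqPairDist Φ gA gB j = dist (entry Φ gB (j+1)) (entry Φ gA j)` (two arbitrary admissible sequences;
on the diagonal `gA = gB ∘ succ` it is `T4FlagMemory.sh`, `seqPairDist_shift`); `seqPairDist_renewal`: under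
`StepDirect ℓ′`, `StepMemory M′`, `StepShift src`,
`seqPairDist j ≤ src j + ℓ′|g^A_j − g^B_{j+1}| + Σ_{m<j} M′_{j,m}·seqPairDist m` — ONE chain of three triangle
inequalities through the step-j map applied, at run B's coupling and then at run A's, to run B's SHIFTED flag (shift
source; birth term; memory of the older pairs).  For two runs in the box up to K / K + 1, `pairDist Φ gA gB K` :=
`seqPairDist` of the clamped sequences, and: `twoRunRenewal_of_scheme` : (D)+(M)+(S)+`src ≤ aρ^k` ⇒
`T4TwoRunMatching.TwoRunRenewal a ℓ′ ρ M′ gA gB (pairDist Φ gA gB K) K`; `twoRunReadOut_of_scheme` : `Represents Φ r γ S.β1`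
+ `ReadLipschitz r cr` ⇒ `T4TwoRunMatching.TwoRunReadOut S cr gA gB (pairDist Φ gA gB K) K`.

(§3) THE TWO CLOSURES FROM ONE INPUT LIST.  `disc_le_of_scheme_twoRun` / `injectedRate_of_scheme_twoRun` (composition
with `T4TwoRunMatching.disc_le_of_twoRun` / `injectedRate_of_twoRun_runs`); `injectedRate_of_split_scheme_eventual`
(composition of `T4FlagMemory.ne4_of_split_scheme` with `T4CouplingMatching.injectedRate_of_runs_eventual`);
`rate_constants_agree` (the two output constants are the same real number).
WHAT THE SINGLE Φ PRESUPPOSES (v1.2, docstring-only — every statement byte-identical to v1.1; audit advisory A12 of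
`t4/b2b-balaban-t4-ref3-g2/AUDIT-pass3.md` §G, cell GAPS C-t4r3-7).  In `injectedRate_of_scheme_twoRun` and
`injectedRate_of_split_scheme_eventual` ONE step family `Φ j` with ONE list of constants serves run K (step j on a torus
of L^{m+K−j} unit blocks) and run K + 1 (step j, resp. j + 1, on a torus of L^{m+K+1−j} blocks) for EVERY cutoff K: the
runs are quantified inside (`hrun : ∀ K, …`), the scheme outside.  So the entry space `X` is to be READ as a K-FREE space
of LOCAL entries — per-unit-volume kernels / local activities at the scale η = L^{−j}; the torus size enters only
through the support of an entry, never through its norm — which is the reading the companion record takes for the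
read-out ((S3): β_{j+1} is defined after *"we take a limit of these functions as T^{(j+1)} ↗ Z^d"*, [Balaban1987RG1]
p. 264 (1.21); read-out constant per unit volume, convention (C5)) — and NOT as the global functional E^{(j)} (a sum over
L^{4(m+K−j)} blocks, whose Lipschitz moduli in the couplings would scale with the volume).  Nothing in the kernel content
depends on this reading; it closes the only reading under which the K-uniformity of the output constants could be
questioned.  The lineage's gen-3 leaf `T4BetaReadOut` types the same read-out over node U3's carrier-polymorphic shapes
(`T4OutputRate`), where the carrier (infinite-volume domains, probe backgrounds) is an explicit parameter.

(§4) NON-VACUITY [folklore]: for `T4FlagMemory.linStep` (every shape with non-zero memory) the two-run renewal holds for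
ANY two runs in the box with `a = C′ℓ′γω`, `ρ = ω` (`twoRunRenewal_linStep`).

(§5) RELATIVISATION TO AN INVARIANT ADMISSIBLE SET OF ENTRIES (v1.1; answers the typing advisory A of the cell cross-read
of `T4FlagMemory` v1.1, GAPS C-pv12g12-3: the one-step shapes of `T4FlagMemory` bind ALL flags `y y′ : ℕ → X`).  Print's
one-step statements are statements on the INDUCTIVE SPACE only — [Balaban1988Convergent] p. 262 (render
`…/1988-cmp119-convergent-renormalization/…-p020-x2.png`, read by THIS seat as an image): *"All the inductive assumptions
are formulated for the effective density obtained after the k-th operation RT. … More precisely, the expressions with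
indices j < k are exactly as described above, but the newly created expressions E^{(k)}, R^{(k)}, B^{(k)} are defined on
slightly larger spaces, with the coefficients in their definition bigger by β multiplied by a corresponding number, and
they have better decay properties, with the number κ replaced, for example, by (1 + 4β)κ."*; Theorem 1 *"There exist
constants, introduced in the above description, such that if the sequence of coupling constants {g_k}, determined by the
recursive renormalization group (Callan-Symanzik) equations (0.18), (0.20) [I], satisfies the inequalities (I.0.33), then
the sequence of densities {ρ_k}, generated by successive applications of the operations RT to the density
ρ₀ = exp[−(1/g₀²)A − E], satisfies all the inductive assumptions. The constants satisfy numerous restrictions introduced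
in the proof."*; and *"The second remark concerns a possible generalization of this theorem. For a given index k we
introduce the space of all densities satisfying the conditions of the inductive assumption. The theorem states that the
operation RT transforms the space with the index k into the space with the index k + 1. This generalization does not seem
to be useful, or interesting now."*  §5 types exactly this formulation for the entries: an ADMISSIBLE SET `P ⊆ X`
(HYPOTHESIS SHAPE `StepInvariant Φ P`: every step map sends flags of admissible entries to an admissible entry — the
k-uniform reading of "RT transforms the space with the index k into the space with the index k + 1"; NOT PRINTED as a
k-uniform statement, cf. "slightly larger spaces"), the RELATIVISED shapes `StepMemoryOn Φ P M′`, `StepDirectOn Φ P ℓ′ γ`,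
`ReadLipschitzOn r P cr` (the moduli asked only between admissible flags / at admissible entries), and proves
(`ne4_of_split_scheme_on`, `injectedRate_of_scheme_twoRun_on`) that they give the SAME conclusions with the SAME
constants, by running `T4FlagMemory` on the subtype `↥P` (`restrictStep`; the generated flags, the shifted padded flags
of `StepShift` and the represented β all live in `P` once the padding value `default` is admissible, `coe_flag_restrict` /
`coe_entry_restrict`).  So the globality of the v1 shapes costs nothing: an instantiation for (2.13) owes the moduli on
its inductive space only — which is the map-between-spaces formulation the author names and sets aside (the WALL of the
companion record §1 (S5) is unchanged; this only removes a typing objection to the booking).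

Deliberately NOT here: any instance of the four hypotheses (or of `StepInvariant`) for Bałaban's (2.13); the β⁰/(AF-0r)
half (β sub-cell); which of the two windows the spine should book (a carver decision, record §8).  Imports `T4FlagMemory` (hence
`T4BetaMemorySharp`, `T4BetaMemory`, `T4CouplingMatching`, `FlowStep`, `B12Beta`, `T4CauchySum`) and `T4TwoRunMatching`,
modifies nothing; Mathlib otherwise; no `sorry`, no `axiom`.  Unit `b2b-balaban-t4-ne4-p1-g2` (gen 2 of PROVER P1 for
NE4, technique "discrete-Grönwall / fading-memory recursion"; journal claim T4-U2.NE4-PROVE-P1b*, CLAIMS.log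
2026-08-19); companion record `t4/T4-EST-NE4-P1.md` v1.2.

CITATION HEADER (lean-in-tree rule 2026-08-18).  T. Bałaban, *Renormalization group approach to lattice gauge field
theories. I*, Commun. Math. Phys. **109** (1987) 249–301 [Balaban1987RG1] (cell paper B12 = [I]; journal page = PDF
page + 248); T. Bałaban, *Convergent renormalization expansions for lattice gauge theories*, Commun. Math. Phys. **119**
(1988) 243–285 [Balaban1988Convergent] (cell paper B14 = [III]; journal page = PDF page + 242; p. 262 quoted in §5).
Printed TEMPLATE of a geometric scale rate in a sibling model (shape only): C. King, Commun. Math. Phys. **102** (1986)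
649–677, Thm 3.4 (3.9) p. 656 [King1986].
-/

namespace Literature.MathematicalPhysics.QuantumFieldTheory.Balaban1983to89.T4FlagMemoryTwoRun

open Literature.MathematicalPhysics.QuantumFieldTheory.Balaban1983to89
open Literature.MathematicalPhysics.QuantumFieldTheory.Balaban1983to89.FlowStep
open Literature.MathematicalPhysics.QuantumFieldTheory.Balaban1983to89.T4CouplingMatching
open Literature.MathematicalPhysics.QuantumFieldTheory.Balaban1983to89.T4FlagMemory
open Literature.MathematicalPhysics.QuantumFieldTheory.Balaban1983to89.T4TwoRunMatching
open Finset

/-! ## §1 Prefix locality of the generated flag -/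

section Locality

variable {X : Type*} [Inhabited X]

/-- PREFIX LOCALITY OF THE FLAG: the flag before step `j` depends on the couplings `g_m`, `m < j`, only — the kernel
form of (0.23) p. 256 ("a new expression of this type is created, in the old only a background field is changed": the
entry born at m is a function of g₀, …, g_m and is never rewritten). [cite: Balaban1987RG1, (0.23) p.256] -/
theorem flag_congr (Φ : ℕ → ℝ → (ℕ → X) → X) {g g' : ℕ → ℝ} :
    ∀ j, (∀ m, m < j → g m = g' m) → flag Φ g j = flag Φ g' j := by
  intro j
  induction j with
  | zero => intro _; funext m; simp [flag]
  | succ j ih =>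
      intro h
      have hj : flag Φ g j = flag Φ g' j := ih fun m hm => h m (Nat.lt_succ_of_lt hm)
      have hg : g j = g' j := h j (Nat.lt_succ_self j)
      funext m
      simp only [flag, hj, hg]

/-- PREFIX LOCALITY OF THE ENTRIES: the entry born at step `j` depends on `g₀, …, g_j` only ((0.23) p. 256 with
(2.13) p. 268: E^{(k+1)} is a function of g_k and of the previous flag E_k). [cite: Balaban1987RG1, (2.13) p.268] -/
theorem entry_congr (Φ : ℕ → ℝ → (ℕ → X) → X) {g g' : ℕ → ℝ} {j : ℕ} (h : ∀ m, m ≤ j → g m = g' m) :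
    entry Φ g j = entry Φ g' j := by
  rw [entry_def, entry_def, flag_congr Φ j (fun m hm => h m hm.le), h j le_rfl]

/-- The clamped extension of a run's prefix `(g_0, …, g_N)` agrees with the run on `m ≤ N`. [folklore] -/
theorem extd_prefixOf {g : ℕ → ℝ} {N m : ℕ} (hm : m ≤ N) : extd (prefixOf g N) m = g m := by
  simp [extd, hm]

/-- Hence the entry born at `j ≤ N` is the same whether read along the clamped prefix of length `j + 1` (as
`T4FlagMemory.Represents` does for `β j (prefixOf g j)`) or along the clamped prefix of length `N + 1` (one sequence per
run). [folklore] -/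
theorem entry_extd_prefixOf (Φ : ℕ → ℝ → (ℕ → X) → X) (g : ℕ → ℝ) {j N : ℕ} (hjN : j ≤ N) :
    entry Φ (extd (prefixOf g j)) j = entry Φ (extd (prefixOf g N)) j :=
  entry_congr Φ fun m hm => by rw [extd_prefixOf hm, extd_prefixOf (hm.trans hjN)]

end Locality

/-! ## §2 The join: one-step shapes ⇒ the two located estimates of the two-run system -/

section Join

variable {X : Type*} [PseudoMetricSpace X] [Inhabited X]

/-- The discrepancy of the j-th MATCHED PAIR of entries of two coupling sequences: run B's entry born at `j + 1` against
run A's entry born at `j` (B has one more ultraviolet step; [Balaban1987RG1] p. 256 "ε = L^{−K} … k = 0, 1, …, K").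
[cite: Balaban1987RG1, (0.20) p.256] -/
noncomputable def seqPairDist (Φ : ℕ → ℝ → (ℕ → X) → X) (gA gB : ℕ → ℝ) (j : ℕ) : ℝ :=
  dist (entry Φ gB (j + 1)) (entry Φ gA j)

/-- On the diagonal (run A's couplings = run B's shifted by one) the pair discrepancy is `T4FlagMemory.sh`. [folklore] -/
theorem seqPairDist_shift (Φ : ℕ → ℝ → (ℕ → X) → X) (g : ℕ → ℝ) (k : ℕ) :
    seqPairDist Φ (fun m => g (m + 1)) g k = sh Φ g k := rfl

/-- **THE TWO-SEQUENCE RENEWAL INEQUALITY (the join, sequence form).**  Under `StepDirect Φ ℓ′ γ`, `StepMemory Φ M′`,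
`StepShift Φ γ src`, for admissible sequences `gA`, `gB` and every `j`:
`seqPairDist j ≤ src j + ℓ′|g^A_j − g^B_{j+1}| + Σ_{m<j} M′_{j,m} · seqPairDist m` — run B's entry born at j + 1 is
within `src j` of the STEP-j map at B's coupling `g^B_{j+1}` on B's shifted flag (shift source), which is within
`ℓ′|g^B_{j+1} − g^A_j|` of the step-j map at A's coupling on the same flag (birth term), which is within the memory sum
of run A's entry born at j (B's shifted flag lists B's entries born at m + 1, A's flag lists A's entries born at m:
the older matched pairs).  The diagonal case (no birth term) is `T4FlagMemory.dataRenewal_sh`. [folklore] -/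
theorem seqPairDist_renewal {Φ : ℕ → ℝ → (ℕ → X) → X} {M' : ℕ → ℕ → ℝ} {src : ℕ → ℝ} {ℓ' γ : ℝ}
    {gA gB : ℕ → ℝ} (hdir : StepDirect Φ ℓ' γ) (hmem : StepMemory Φ M') (hsh : StepShift Φ γ src)
    (hA : Adm γ gA) (hB : Adm γ gB) (j : ℕ) :
    seqPairDist Φ gA gB j
      ≤ src j + ℓ' * |gA j - gB (j + 1)| + ∑ m ∈ range j, M' j m * seqPairDist Φ gA gB m := by
  have h1 : dist (entry Φ gB (j + 1))
      (Φ j (gB (j + 1)) (fun m => if m < j then entry Φ gB (m + 1) else default)) ≤ src j := hsh gB hB j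
  have h2 : dist (Φ j (gB (j + 1)) (fun m => if m < j then entry Φ gB (m + 1) else default))
      (Φ j (gA j) (fun m => if m < j then entry Φ gB (m + 1) else default)) ≤ ℓ' * |gA j - gB (j + 1)| := by
    rw [abs_sub_comm]
    exact hdir j _ _ _ (hB (j + 1)).1 (hB (j + 1)).2 (hA j).1 (hA j).2
  have h3 : dist (Φ j (gA j) (fun m => if m < j then entry Φ gB (m + 1) else default)) (entry Φ gA j)
      ≤ ∑ m ∈ range j, M' j m * seqPairDist Φ gA gB m := by
    rw [entry_def Φ gA j]
    refine (hmem j (gA j) _ (flag Φ gA j)).trans (le_of_eq ?_)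
    refine Finset.sum_congr rfl fun m hm => ?_
    have hmj : m < j := mem_range.mp hm
    simp only [if_pos hmj, flag_apply, seqPairDist]
  calc seqPairDist Φ gA gB j
      ≤ dist (entry Φ gB (j + 1)) (Φ j (gB (j + 1)) (fun m => if m < j then entry Φ gB (m + 1) else default))
        + dist (Φ j (gB (j + 1)) (fun m => if m < j then entry Φ gB (m + 1) else default))
            (Φ j (gA j) (fun m => if m < j then entry Φ gB (m + 1) else default))
        + dist (Φ j (gA j) (fun m => if m < j then entry Φ gB (m + 1) else default)) (entry Φ gA j) :=
        dist_triangle4 _ _ _ _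
    _ ≤ src j + ℓ' * |gA j - gB (j + 1)| + ∑ m ∈ range j, M' j m * seqPairDist Φ gA gB m :=
        add_le_add (add_le_add h1 h2) h3

/-- The scheme's discrepancy majorant for TWO RUNS in the box (run A: couplings `g^A_i`, `i ≤ K`; run B: `g^B_i`,
`i ≤ K + 1`): the pair discrepancy along the CLAMPED coupling sequences `extd (prefixOf gA K)`, `extd (prefixOf gB (K+1))`
(admissible by `T4FlagMemory.extd_adm`; the clamping beyond the runs' last scales is never read, §1). [folklore] -/
noncomputable def pairDist (Φ : ℕ → ℝ → (ℕ → X) → X) (gA gB : ℕ → ℝ) (K j : ℕ) : ℝ :=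
  seqPairDist Φ (extd (prefixOf gA K)) (extd (prefixOf gB (K + 1))) j

/-- `pairDist ≥ 0`. [folklore] -/
theorem pairDist_nonneg (Φ : ℕ → ℝ → (ℕ → X) → X) (gA gB : ℕ → ℝ) (K j : ℕ) : 0 ≤ pairDist Φ gA gB K j :=
  dist_nonneg

/-- **JOIN (i): THE ONE-STEP SHAPES DELIVER `T4TwoRunMatching.TwoRunRenewal`.**  Under `StepDirect Φ ℓ′ γ` (birth
modulus), `StepMemory Φ M′` (memory), `StepShift Φ γ src` with `src k ≤ aρ^k` (source), for two runs in the box ]0,γ] up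
to scales K / K + 1: `TwoRunRenewal a ℓ′ ρ M′ gA gB (pairDist Φ gA gB K) K` — technique P2's located renewal estimate,
with ITS memory kernel `M` = the scheme's `M′` and ITS majorant `s` = the scheme's `pairDist`.  HYPOTHESES ONLY about
the scheme; nothing of [Balaban1987RG1] is asserted. [cite: Balaban1987RG1, (2.12)-(2.13) p.268] -/
theorem twoRunRenewal_of_scheme {Φ : ℕ → ℝ → (ℕ → X) → X} {M' : ℕ → ℕ → ℝ} {src : ℕ → ℝ} {ℓ' γ a ρ : ℝ}
    {K : ℕ} {gA gB : ℕ → ℝ} (hdir : StepDirect Φ ℓ' γ) (hmem : StepMemory Φ M') (hsh : StepShift Φ γ src)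
    (hsrc : ∀ k, src k ≤ a * ρ ^ k)
    (hAbox : ∀ i, i ≤ K → 0 < gA i ∧ gA i ≤ γ) (hBbox : ∀ i, i ≤ K + 1 → 0 < gB i ∧ gB i ≤ γ) :
    TwoRunRenewal a ℓ' ρ M' gA gB (pairDist Φ gA gB K) K := by
  intro j hj
  have hA : Adm γ (extd (prefixOf gA K)) := extd_adm (prefixOf_mem_box le_rfl hAbox)
  have hB : Adm γ (extd (prefixOf gB (K + 1))) := extd_adm (prefixOf_mem_box le_rfl hBbox)
  have h := seqPairDist_renewal hdir hmem hsh hA hB j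
  rw [extd_prefixOf hj.le, extd_prefixOf (show j + 1 ≤ K + 1 by omega)] at h
  have hs := hsrc j
  unfold pairDist
  linarith

/-- **JOIN (ii): REPRESENTATION + READ-OUT DELIVER `T4TwoRunMatching.TwoRunReadOut`.**  If the remainder family `S.β1`
of the printed one-loop split is READ OFF the scheme (`Represents Φ r γ S.β1`, (1.20)–(1.22)/(2.15): β from the new
entry by a fixed recipe) with `ReadLipschitz r cr`, then for two runs in the box
`TwoRunReadOut S cr gA gB (pairDist Φ gA gB K) K`: the β¹-mismatch of the partnered steps is at most `cr ×` the pair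
discrepancy (prefix locality §1 puts both β¹-values on the clamped sequences).  HYPOTHESES ONLY about the scheme.
[cite: Balaban1987RG1, (2.15) p.268] -/
theorem twoRunReadOut_of_scheme {β : HBeta} (S : B12Beta.OneLoopSplit β) {Φ : ℕ → ℝ → (ℕ → X) → X} {r : X → ℝ}
    {γ cr : ℝ} {K : ℕ} {gA gB : ℕ → ℝ} (hrep : Represents Φ r γ S.β1) (hr : ReadLipschitz r cr)
    (hAbox : ∀ i, i ≤ K → 0 < gA i ∧ gA i ≤ γ) (hBbox : ∀ i, i ≤ K + 1 → 0 < gB i ∧ gB i ≤ γ) :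
    TwoRunReadOut S cr gA gB (pairDist Φ gA gB K) K := by
  intro j hj
  unfold remMismatch pairDist seqPairDist
  rw [hrep (j + 1) _ (prefixOf_mem_box (show j + 1 ≤ K + 1 by omega) hBbox),
    hrep j _ (prefixOf_mem_box hj.le hAbox),
    entry_extd_prefixOf Φ gB (show j + 1 ≤ K + 1 by omega), entry_extd_prefixOf Φ gA hj.le]
  exact hr _ _

end Join

/-! ## §3 Node U2's two closures from ONE input list -/

section Closures

variable {X : Type*} [PseudoMetricSpace X] [Inhabited X]

/-- **NODE U2 CLOSED BY THE TWO-RUN FIXED POINT FROM THE ONE-STEP INPUTS (one pair of runs).**  The four one-step shapes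
for a scheme representing the remainder `S.β1` (`StepDirect ℓ′`, `StepMemory M′` with `FadingMemory C′ ω M′`,
`StepShift src ≤ aρ^k`, `ReadLipschitz cr`), the memory gap `(1 + C′)ω < ρ < 1`, (AF-0r) `|β⁰_{k+1} − β∞| ≤ c₀ρ^k` (β
sub-cell; binder `hconv`), two runs of the printed recursion (0.20) in the box ]0,γ] pinned at the end (node U1/H3;
binders), and the window `cr·ℓ′γ³·(ρ−ω)(ρ−(1+C′)ω)⁻¹ ≤ (1−ρ)/2` — NO lower bound on β — give
`disc gA gB j ≤ 2(2c₀ + cr·a·κ)(1−ρ)⁻¹ρ^j` (`j ≤ K`, `κ = (ρ−ω)(ρ−(1+C′)ω)⁻¹`) and the geometric bound on `pairDist`.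
`T4TwoRunMatching.disc_le_of_twoRun` ∘ §2.  Bookkeeping over UNPRINTED inputs. [cite: Balaban1987RG1, (0.20) p.256 and (2.13) p.268] -/
theorem disc_le_of_scheme_twoRun {β : HBeta} (S : B12Beta.OneLoopSplit β) {Φ : ℕ → ℝ → (ℕ → X) → X} {r : X → ℝ}
    {M' : ℕ → ℕ → ℝ} {src : ℕ → ℝ} {ℓ' C' ω γ cr a ρ binf c₀ : ℝ} {K : ℕ} {gA gB : ℕ → ℝ}
    (hρ1 : ρ < 1) (hω : 0 ≤ ω) (hC' : 0 ≤ C') (hsmall : (1 + C') * ω < ρ)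
    (hc₀ : 0 ≤ c₀) (ha : 0 ≤ a) (hℓ' : 0 ≤ ℓ') (hcr : 0 ≤ cr)
    (hrep : Represents Φ r γ S.β1) (hr : ReadLipschitz r cr) (hdir : StepDirect Φ ℓ' γ)
    (hmem : StepMemory Φ M') (hM' : FadingMemory C' ω M') (hsh : StepShift Φ γ src)
    (hsrc : ∀ k, src k ≤ a * ρ ^ k)
    (hA : RGEqH K β gA) (hB : RGEqH (K + 1) β gB)
    (hAbox : ∀ i, i ≤ K → 0 < gA i ∧ gA i ≤ γ) (hBbox : ∀ i, i ≤ K + 1 → 0 < gB i ∧ gB i ≤ γ)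
    (hpin : gA K = gB (K + 1))
    (hconv : ∀ k, |S.β0 k - binf| ≤ c₀ * ρ ^ k)
    (hgain : cr * (ℓ' * γ ^ 3) * ((ρ - ω) / (ρ - (1 + C') * ω)) ≤ (1 - ρ) / 2) :
    (∀ j, j ≤ K → disc gA gB j ≤ 2 * (2 * c₀ + cr * a * ((ρ - ω) / (ρ - (1 + C') * ω))) / (1 - ρ) * ρ ^ j) ∧
    (∀ j, j < K → pairDist Φ gA gB K j ≤ (a + ℓ' * γ ^ 3 * (2 * (2 * c₀ + cr * a *
      ((ρ - ω) / (ρ - (1 + C') * ω))) / (1 - ρ))) * ((ρ - ω) / (ρ - (1 + C') * ω)) * ρ ^ j) :=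
  disc_le_of_twoRun S hρ1 hω hC' hsmall hc₀ ha hℓ' hcr hA hB hAbox hBbox hpin hconv
    (twoRunReadOut_of_scheme S hrep hr hAbox hBbox) (twoRunRenewal_of_scheme hdir hmem hsh hsrc hAbox hBbox)
    (fun j _ => pairDist_nonneg Φ gA gB K j) hM' hgain

/-- **NODE U2's SPINE OUTPUT BY THE TWO-RUN CLOSURE, K-UNIFORM, FROM THE ONE-STEP INPUTS.**  For the family of
infrared-pinned runs `g K` (K steps from ε = L^{−K}; (0.20), box, pin — binders), a scheme representing `S.β1` with the
four one-step shapes and constants FREE OF K, the memory gap, (AF-0r) and the window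
`cr·ℓ′γ³·(ρ−ω)(ρ−(1+C′)ω)⁻¹ ≤ (1−ρ)/2`: `T4CauchySum.InjectedRate (2(2c₀ + cr·a·κ)(1−ρ)⁻¹) 0 ρ (fun K j ↦ disc (g K) (g (K+1)) j)`.
Compared with the box-uniform closure `injectedRate_of_split_scheme_eventual`: SAME inputs (M)(S)(D)(R) + (AF-0r), NO
`EventualLowerH`, window in `γ³` instead of `(k₀+1)γ³ + 2γ/b`.  `T4TwoRunMatching.injectedRate_of_twoRun_runs` ∘ §2.
Bookkeeping over UNPRINTED inputs; NOT summit progress. [cite: Balaban1987RG1, (0.20) p.256 and Thm 2 p.259] -/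
theorem injectedRate_of_scheme_twoRun {β : HBeta} (S : B12Beta.OneLoopSplit β) {Φ : ℕ → ℝ → (ℕ → X) → X}
    {r : X → ℝ} {M' : ℕ → ℕ → ℝ} {src : ℕ → ℝ} {ℓ' C' ω γ cr a ρ binf c₀ : ℝ} (g : ℕ → ℕ → ℝ) (gIR : ℝ)
    (hρ1 : ρ < 1) (hω : 0 ≤ ω) (hC' : 0 ≤ C') (hsmall : (1 + C') * ω < ρ)
    (hc₀ : 0 ≤ c₀) (ha : 0 ≤ a) (hℓ' : 0 ≤ ℓ') (hcr : 0 ≤ cr)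
    (hrep : Represents Φ r γ S.β1) (hr : ReadLipschitz r cr) (hdir : StepDirect Φ ℓ' γ)
    (hmem : StepMemory Φ M') (hM' : FadingMemory C' ω M') (hsh : StepShift Φ γ src)
    (hsrc : ∀ k, src k ≤ a * ρ ^ k)
    (hrun : ∀ K, RGEqH K β (g K)) (hbox : ∀ K i, i ≤ K → 0 < g K i ∧ g K i ≤ γ) (hpin : ∀ K, g K K = gIR)
    (hconv : ∀ k, |S.β0 k - binf| ≤ c₀ * ρ ^ k)
    (hgain : cr * (ℓ' * γ ^ 3) * ((ρ - ω) / (ρ - (1 + C') * ω)) ≤ (1 - ρ) / 2) :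
    T4CauchySum.InjectedRate (2 * (2 * c₀ + cr * a * ((ρ - ω) / (ρ - (1 + C') * ω))) / (1 - ρ)) 0 ρ
      (fun K j => disc (g K) (g (K + 1)) j) :=
  injectedRate_of_twoRun_runs S g gIR hρ1 hω hC' hsmall hc₀ ha hℓ' hcr hrun hbox hpin hconv
    (fun K => twoRunReadOut_of_scheme S hrep hr (hbox K) (hbox (K + 1)))
    (fun K => twoRunRenewal_of_scheme hdir hmem hsh hsrc (hbox K) (hbox (K + 1)))
    (fun K j _ => pairDist_nonneg Φ (g K) (g (K + 1)) K j) (fun _ => hM') hgain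

/-- **NODE U2's SPINE OUTPUT BY THE BOX-UNIFORM CLOSURE, SPLIT FORM (for comparison).**  The same scheme inputs and
(AF-0r) through `T4FlagMemory.ne4_of_split_scheme` (node U2's three box-uniform inputs for the FULL β) and
`T4CouplingMatching.injectedRate_of_runs_eventual`: here the remaining conditionals are an EVENTUAL LOWER BOUND
`EventualLowerH b γ k₀ β` on the β-functions (β sub-cell, `LimitForm.tail_lower` shape; binder `hlo`) and the window
`cr·ℓ′·((k₀+1)γ³ + 2γ/b) ≤ (1−ρ)/2`; output constant `2(2c₀ + cr·a(ρ−ω)(ρ−(1+C′)ω)⁻¹)(1−ρ)⁻¹` (= the two-run one,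
`rate_constants_agree`).  Bookkeeping over UNPRINTED inputs; NOT summit progress. [cite: Balaban1987RG1, (0.20) p.256 and Thm 2 p.259] -/
theorem injectedRate_of_split_scheme_eventual {β : HBeta} (S : B12Beta.OneLoopSplit β)
    {Φ : ℕ → ℝ → (ℕ → X) → X} {r : X → ℝ} {M' : ℕ → ℕ → ℝ} {src : ℕ → ℝ}
    {ℓ' C' ω γ cr a ρ b binf c₀ : ℝ} {k₀ : ℕ} (g : ℕ → ℕ → ℝ) (gIR : ℝ)
    (hγ : 0 < γ) (hb : 0 < b) (hρ1 : ρ < 1)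
    (hℓ' : 0 ≤ ℓ') (hC' : 0 ≤ C') (hω : 0 ≤ ω) (hcr : 0 ≤ cr) (ha : 0 ≤ a) (hc₀ : 0 ≤ c₀)
    (hsmall : (1 + C') * ω < ρ)
    (hconv : ∀ k, |S.β0 k - binf| ≤ c₀ * ρ ^ k)
    (hrep : Represents Φ r γ S.β1) (hr : ReadLipschitz r cr) (hdir : StepDirect Φ ℓ' γ)
    (hmem : StepMemory Φ M') (hM' : FadingMemory C' ω M') (hsh : StepShift Φ γ src)
    (hsrc : ∀ k, src k ≤ a * ρ ^ k)
    (hrun : ∀ K, RGEqH K β (g K)) (hbox : ∀ K i, i ≤ K → 0 < g K i ∧ g K i ≤ γ)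
    (hpin : ∀ K, g K K = gIR) (hlo : EventualLowerH b γ k₀ β)
    (hsmall₂ : cr * ℓ' * (((k₀ : ℝ) + 1) * γ ^ 3 + 2 * γ / b) ≤ (1 - ρ) / 2) :
    T4CauchySum.InjectedRate (2 * (2 * c₀ + cr * (a * (ρ - ω) / (ρ - (1 + C') * ω))) / (1 - ρ)) 0 ρ
      (fun K j => disc (g K) (g (K + 1)) j) := by
  obtain ⟨hS, hL, hΛ⟩ :=
    ne4_of_split_scheme S hℓ' hC' hω hcr ha hc₀ hsmall hρ1.le hconv hrep hr hdir hmem hM' hsh hsrc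
  have hν0 : 0 ≤ (1 + C') * ω := mul_nonneg (by linarith) hω
  have hρ0 : 0 < ρ := lt_of_le_of_lt hν0 hsmall
  have hωρ : ω < ρ := by nlinarith
  have hc : 0 ≤ 2 * c₀ + cr * (a * (ρ - ω) / (ρ - (1 + C') * ω)) :=
    add_nonneg (by positivity)
      (mul_nonneg hcr (div_nonneg (mul_nonneg ha (sub_pos.mpr hωρ).le) (sub_pos.mpr hsmall).le))
  exact T4CouplingMatching.injectedRate_of_runs_eventual g gIR hγ hb hρ0 hρ1 hc (mul_nonneg hcr hℓ')
    hrun hbox hpin hS hL hΛ hlo hsmall₂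

/-- The two closures deliver the SAME output constant (the printed forms of the two theorems differ only by
association). [folklore] -/
theorem rate_constants_agree (c₀ cr a ρ ω C' : ℝ) :
    2 * (2 * c₀ + cr * (a * (ρ - ω) / (ρ - (1 + C') * ω))) / (1 - ρ)
      = 2 * (2 * c₀ + cr * a * ((ρ - ω) / (ρ - (1 + C') * ω))) / (1 - ρ) := by
  ring

end Closures

/-! ## §4 Non-vacuity: the linear scheme satisfies the two-run renewal along any two runs in the box -/

section Witness

/-- For `T4FlagMemory.linStep ℓ′ C′ ω` (direct modulus ℓ′, memory `C′ω^{j−m}`, shift source `(C′ℓ′γω)ω^k`) and ANY two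
runs in the box ]0,γ] up to K / K + 1, technique P2's renewal estimate holds with `a = C′ℓ′γω`, `ρ = ω`, `M = C′ω^{j−m}`
and the scheme's own majorant — the join is not vacuous and carries genuinely non-zero memory. [folklore] -/
theorem twoRunRenewal_linStep {ℓ' C' ω γ : ℝ} (hℓ' : 0 ≤ ℓ') (hC' : 0 ≤ C') (hω : 0 ≤ ω) {K : ℕ}
    {gA gB : ℕ → ℝ} (hAbox : ∀ i, i ≤ K → 0 < gA i ∧ gA i ≤ γ) (hBbox : ∀ i, i ≤ K + 1 → 0 < gB i ∧ gB i ≤ γ) :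
    TwoRunRenewal (C' * ℓ' * γ * ω) ℓ' ω (fun j m => C' * ω ^ (j - m)) gA gB
      (pairDist (linStep ℓ' C' ω) gA gB K) K :=
  twoRunRenewal_of_scheme (linStep_direct hℓ') (linStep_memory hC' hω) (linStep_shift hℓ' hC' hω)
    (fun _ => le_rfl) hAbox hBbox

end Witness

/-! ## §5 Relativisation: the shapes need only hold on an invariant admissible set of entries (v1.1) -/

section Admissible

variable {X : Type*}

/-- HYPOTHESIS SHAPE — the k-uniform reading of [Balaban1988Convergent] Thm 1 / p. 262 "the operation RT transforms the
space with the index k into the space with the index k + 1": an ADMISSIBLE SET of entries `P` is invariant under every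
step map applied to a flag of admissible entries (any coupling; outside the box ]0,γ] an instantiation extends `Φ j` by
its value at an admissible coupling, which changes none of the shapes).  NOT PRINTED as a k-uniform statement ("slightly
larger spaces"); never asserted here. [cite: Balaban1988Convergent, Thm 1 p.262] -/
def StepInvariant (Φ : ℕ → ℝ → (ℕ → X) → X) (P : Set X) : Prop :=
  ∀ j (g : ℝ) (y : ℕ → X), (∀ m, y m ∈ P) → Φ j g y ∈ P

/-- The scheme RESTRICTED to the admissible subtype `↥P` under `StepInvariant` (print's map between the inductive
spaces, p. 262, as a family of maps on one space of admissible entries). [cite: Balaban1988Convergent, p.262] -/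
def restrictStep (Φ : ℕ → ℝ → (ℕ → X) → X) (P : Set X) (hinv : StepInvariant Φ P) :
    ℕ → ℝ → (ℕ → P) → P :=
  fun j g y => ⟨Φ j g (fun m => (y m : X)), hinv j g _ fun m => (y m).2⟩

/-- The restricted step map, read back in `X`, is the original step map on the underlying flag. [folklore] -/
@[simp] theorem coe_restrictStep (Φ : ℕ → ℝ → (ℕ → X) → X) {P : Set X} (hinv : StepInvariant Φ P) (j : ℕ)
    (g : ℝ) (y : ℕ → P) : ((restrictStep Φ P hinv j g y : P) : X) = Φ j g (fun m => (y m : X)) := rfl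

variable [PseudoMetricSpace X]

/-- HYPOTHESIS SHAPE — `T4FlagMemory.StepMemory` RELATIVISED: the functional-memory modulus asked only between two flags
of ADMISSIBLE entries ("the space of all densities satisfying the conditions of the inductive assumption", p. 262).
NOT PRINTED (companion record §1 (S5)); never asserted here. [cite: Balaban1988Convergent, p.262] -/
def StepMemoryOn (Φ : ℕ → ℝ → (ℕ → X) → X) (P : Set X) (M' : ℕ → ℕ → ℝ) : Prop :=
  ∀ j (g : ℝ) (y y' : ℕ → X), (∀ m, y m ∈ P) → (∀ m, y' m ∈ P) →
    dist (Φ j g y) (Φ j g y') ≤ ∑ m ∈ range j, M' j m * dist (y m) (y' m)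

/-- HYPOTHESIS SHAPE — `T4FlagMemory.StepDirect` RELATIVISED: the direct modulus in the own coupling asked only at flags
of admissible entries (printed qualitative form per j: [Balaban1987RG1] p. 264 "It is a smooth function defined on the
interval [0, γ], (or analytic), uniformly bounded on this interval together with all derivatives"; one ℓ′ for all j NOT
PRINTED). [cite: Balaban1987RG1, p.264] -/
def StepDirectOn (Φ : ℕ → ℝ → (ℕ → X) → X) (P : Set X) (ℓ' γ : ℝ) : Prop :=
  ∀ j (g g' : ℝ) (y : ℕ → X), (∀ m, y m ∈ P) → 0 < g → g ≤ γ → 0 < g' → g' ≤ γ →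
    dist (Φ j g y) (Φ j g' y) ≤ ℓ' * |g - g'|

/-- HYPOTHESIS SHAPE — `T4FlagMemory.ReadLipschitz` RELATIVISED: the read-out constant asked only between admissible
entries ((1.20)–(1.22) p. 264: β from the second B-derivative of the new entry at 0; constant = norm convention, NOT
PRINTED). [cite: Balaban1987RG1, (1.22) p.264] -/
def ReadLipschitzOn (r : X → ℝ) (P : Set X) (cr : ℝ) : Prop :=
  ∀ x x' : X, x ∈ P → x' ∈ P → |r x - r x'| ≤ cr * dist x x'

/-- The global shapes are the case `P = univ` of the relativised ones (so §5 generalises §3, never the converse).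
[folklore] -/
theorem stepMemoryOn_univ {Φ : ℕ → ℝ → (ℕ → X) → X} {M' : ℕ → ℕ → ℝ} (hmem : StepMemory Φ M') :
    StepMemoryOn Φ Set.univ M' :=
  fun j g y y' _ _ => hmem j g y y'

/-- Relativised memory ⇒ `StepMemory` of the restricted scheme. [folklore] -/
theorem stepMemory_restrict {Φ : ℕ → ℝ → (ℕ → X) → X} {P : Set X} (hinv : StepInvariant Φ P)
    {M' : ℕ → ℕ → ℝ} (hmem : StepMemoryOn Φ P M') : StepMemory (restrictStep Φ P hinv) M' := by
  intro j g y y'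
  have h := hmem j g (fun m => (y m : X)) (fun m => (y' m : X)) (fun m => (y m).2) (fun m => (y' m).2)
  simpa only [Subtype.dist_eq, coe_restrictStep] using h

/-- Relativised direct modulus ⇒ `StepDirect` of the restricted scheme. [folklore] -/
theorem stepDirect_restrict {Φ : ℕ → ℝ → (ℕ → X) → X} {P : Set X} (hinv : StepInvariant Φ P) {ℓ' γ : ℝ}
    (hdir : StepDirectOn Φ P ℓ' γ) : StepDirect (restrictStep Φ P hinv) ℓ' γ := by
  intro j g g' y hg hgγ hg' hg'γ
  have h := hdir j g g' (fun m => (y m : X)) (fun m => (y m).2) hg hgγ hg' hg'γ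
  simpa only [Subtype.dist_eq, coe_restrictStep] using h

/-- Relativised read-out ⇒ `ReadLipschitz` of the restricted read-out. [folklore] -/
theorem readLipschitz_restrict {r : X → ℝ} {P : Set X} {cr : ℝ} (hr : ReadLipschitzOn r P cr) :
    ReadLipschitz (fun x : P => r x) cr := by
  intro x x'
  simpa only [Subtype.dist_eq] using hr x x' x.2 x'.2

variable [Inhabited X] {P : Set X} [Inhabited P]

omit [PseudoMetricSpace X] in
/-- If the padding value is admissible (`↑(default : ↥P) = (default : X)`), the restricted scheme generates, entry by
entry, the SAME flags as the original one: the generated flags never leave `P`. [folklore] -/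
theorem coe_flag_restrict (Φ : ℕ → ℝ → (ℕ → X) → X) (hinv : StepInvariant Φ P)
    (hdef : ((default : P) : X) = default) (g : ℕ → ℝ) :
    ∀ j m, ((flag (restrictStep Φ P hinv) g j m : P) : X) = flag Φ g j m := by
  intro j
  induction j with
  | zero => intro m; simp [flag, hdef]
  | succ j ih =>
      intro m
      by_cases hm : m = j
      · subst hm
        have h1 : flag (restrictStep Φ P hinv) g (m + 1) m
            = restrictStep Φ P hinv m (g m) (flag (restrictStep Φ P hinv) g m) := by simp [flag]
        have h2 : flag Φ g (m + 1) m = Φ m (g m) (flag Φ g m) := by simp [flag]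
        rw [h1, h2, coe_restrictStep]
        congr 1
        funext k
        exact ih k
      · have h1 : flag (restrictStep Φ P hinv) g (j + 1) m = flag (restrictStep Φ P hinv) g j m := by
          simp [flag, hm]
        have h2 : flag Φ g (j + 1) m = flag Φ g j m := by simp [flag, hm]
        rw [h1, h2]
        exact ih m

omit [PseudoMetricSpace X] in
/-- … hence the SAME entries. [folklore] -/
theorem coe_entry_restrict (Φ : ℕ → ℝ → (ℕ → X) → X) (hinv : StepInvariant Φ P)
    (hdef : ((default : P) : X) = default) (g : ℕ → ℝ) (j : ℕ) :
    ((entry (restrictStep Φ P hinv) g j : P) : X) = entry Φ g j := by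
  rw [entry_def, entry_def, coe_restrictStep]
  congr 1
  funext m
  exact coe_flag_restrict Φ hinv hdef g j m

/-- The one-step source `StepShift` (already a statement about GENERATED entries and the shifted PADDED flag only)
transfers to the restricted scheme when the padding value is admissible. [folklore] -/
theorem stepShift_restrict (Φ : ℕ → ℝ → (ℕ → X) → X) (hinv : StepInvariant Φ P)
    (hdef : ((default : P) : X) = default) {γ : ℝ} {src : ℕ → ℝ} (hsh : StepShift Φ γ src) :
    StepShift (restrictStep Φ P hinv) γ src := by
  intro g hg k
  have hflag : (fun m => (((if m < k then entry (restrictStep Φ P hinv) g (m + 1) else default : P)) : X))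
      = fun m => if m < k then entry Φ g (m + 1) else default := by
    funext m
    by_cases hm : m < k
    · rw [if_pos hm, if_pos hm, coe_entry_restrict Φ hinv hdef]
    · rw [if_neg hm, if_neg hm, hdef]
  have h := hsh g hg k
  rw [← hflag] at h
  rw [Subtype.dist_eq, coe_entry_restrict Φ hinv hdef g (k + 1), coe_restrictStep]
  exact h

omit [PseudoMetricSpace X] in
/-- A β-family represented by the scheme is represented by the restricted scheme (same entries). [folklore] -/
theorem represents_restrict (Φ : ℕ → ℝ → (ℕ → X) → X) (hinv : StepInvariant Φ P)
    (hdef : ((default : P) : X) = default) {r : X → ℝ} {γ : ℝ} {β : HBeta} (hrep : Represents Φ r γ β) :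
    Represents (restrictStep Φ P hinv) (fun x : P => r x) γ β := by
  intro k v hv
  show β k v = r ((entry (restrictStep Φ P hinv) (extd v) k : P) : X)
  rw [coe_entry_restrict Φ hinv hdef, hrep k v hv]

/-- **NE4 FOR THE FULL β FROM THE RELATIVISED ONE-STEP INPUTS (split form).**  `T4FlagMemory.ne4_of_split_scheme` with
the memory modulus, the direct modulus and the read-out constant asked ONLY on an invariant admissible set of entries
`P` containing the padding value (print's inductive space, [Balaban1988Convergent] p. 262), the source `StepShift` and
`Represents` as typed (they concern generated entries only): the SAME node-U2 triple with the SAME constants,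
`c = 2c₀ + cr·a(ρ−ω)(ρ−(1+C′)ω)⁻¹`, moduli `cr ℓ′((1+C′)ω)^{k−i}`, under the gap `(1+C′)ω < ρ ≤ 1` and (AF-0r) (binder
`hconv`, β sub-cell).  HYPOTHESES ONLY about the scheme; nothing of [I]–[III] is asserted; NOT summit progress.
[cite: Balaban1988Convergent, Thm 1 p.262] -/
theorem ne4_of_split_scheme_on {β : HBeta} (S : B12Beta.OneLoopSplit β) {Φ : ℕ → ℝ → (ℕ → X) → X}
    (hinv : StepInvariant Φ P) (hdef : ((default : P) : X) = default)
    {r : X → ℝ} {M' : ℕ → ℕ → ℝ} {src : ℕ → ℝ} {ℓ' C' ω γ cr a ρ binf c₀ : ℝ}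
    (hℓ' : 0 ≤ ℓ') (hC' : 0 ≤ C') (hω : 0 ≤ ω) (hcr : 0 ≤ cr) (ha : 0 ≤ a) (hc₀ : 0 ≤ c₀)
    (hsmall : (1 + C') * ω < ρ) (hρ1 : ρ ≤ 1)
    (hconv : ∀ k, |S.β0 k - binf| ≤ c₀ * ρ ^ k)
    (hrep : Represents Φ r γ S.β1) (hr : ReadLipschitzOn r P cr) (hdir : StepDirectOn Φ P ℓ' γ)
    (hmem : StepMemoryOn Φ P M') (hM' : FadingMemory C' ω M') (hsh : StepShift Φ γ src)
    (hsrc : ∀ k, src k ≤ a * ρ ^ k) :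
    ScaleShiftRate (2 * c₀ + cr * (a * (ρ - ω) / (ρ - (1 + C') * ω))) ρ γ β ∧
      HistLipschitz (fun k i => cr * ℓ' * ((1 + C') * ω) ^ (k - i)) γ β ∧
      FadingMemory (cr * ℓ') ρ (fun k i => cr * ℓ' * ((1 + C') * ω) ^ (k - i)) :=
  ne4_of_split_scheme S hℓ' hC' hω hcr ha hc₀ hsmall hρ1 hconv (represents_restrict Φ hinv hdef hrep)
    (readLipschitz_restrict hr) (stepDirect_restrict hinv hdir) (stepMemory_restrict hinv hmem) hM'
    (stepShift_restrict Φ hinv hdef hsh) hsrc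

/-- **NODE U2's SPINE OUTPUT BY THE TWO-RUN CLOSURE FROM THE RELATIVISED ONE-STEP INPUTS.**
`injectedRate_of_scheme_twoRun` with (M), (D), (R) asked only on an invariant admissible set of entries containing the
padding value: the SAME `T4CauchySum.InjectedRate (2(2c₀ + cr·a·κ)(1−ρ)⁻¹) 0 ρ` under the SAME remaining conditionals
(runs / box / pin = node U1/H3, binders; (AF-0r) = `hconv`; gap; window `cr·ℓ′γ³κ ≤ (1−ρ)/2`).  Bookkeeping over
UNPRINTED inputs; NOT summit progress. [cite: Balaban1987RG1, (0.20) p.256 and Thm 2 p.259] -/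
theorem injectedRate_of_scheme_twoRun_on {β : HBeta} (S : B12Beta.OneLoopSplit β) {Φ : ℕ → ℝ → (ℕ → X) → X}
    (hinv : StepInvariant Φ P) (hdef : ((default : P) : X) = default)
    {r : X → ℝ} {M' : ℕ → ℕ → ℝ} {src : ℕ → ℝ} {ℓ' C' ω γ cr a ρ binf c₀ : ℝ} (g : ℕ → ℕ → ℝ) (gIR : ℝ)
    (hρ1 : ρ < 1) (hω : 0 ≤ ω) (hC' : 0 ≤ C') (hsmall : (1 + C') * ω < ρ)
    (hc₀ : 0 ≤ c₀) (ha : 0 ≤ a) (hℓ' : 0 ≤ ℓ') (hcr : 0 ≤ cr)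
    (hrep : Represents Φ r γ S.β1) (hr : ReadLipschitzOn r P cr) (hdir : StepDirectOn Φ P ℓ' γ)
    (hmem : StepMemoryOn Φ P M') (hM' : FadingMemory C' ω M') (hsh : StepShift Φ γ src)
    (hsrc : ∀ k, src k ≤ a * ρ ^ k)
    (hrun : ∀ K, RGEqH K β (g K)) (hbox : ∀ K i, i ≤ K → 0 < g K i ∧ g K i ≤ γ) (hpin : ∀ K, g K K = gIR)
    (hconv : ∀ k, |S.β0 k - binf| ≤ c₀ * ρ ^ k)
    (hgain : cr * (ℓ' * γ ^ 3) * ((ρ - ω) / (ρ - (1 + C') * ω)) ≤ (1 - ρ) / 2) :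
    T4CauchySum.InjectedRate (2 * (2 * c₀ + cr * a * ((ρ - ω) / (ρ - (1 + C') * ω))) / (1 - ρ)) 0 ρ
      (fun K j => disc (g K) (g (K + 1)) j) :=
  injectedRate_of_scheme_twoRun S g gIR hρ1 hω hC' hsmall hc₀ ha hℓ' hcr (represents_restrict Φ hinv hdef hrep)
    (readLipschitz_restrict hr) (stepDirect_restrict hinv hdir) (stepMemory_restrict hinv hmem) hM'
    (stepShift_restrict Φ hinv hdef hsh) hsrc hrun hbox hpin hconv hgain

end Admissible

end Literature.MathematicalPhysics.QuantumFieldTheory.Balaban1983to89.T4FlagMemoryTwoRun
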